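import Literature.Computability.Cryptography.TreeSigDistinguisherRun
import HarnessLib

/-!
# The authentication-tree scheme, VI: the two PRF games of the distinguisher

Topic `Literature/Computability/Cryptography`; continues `TreeSigDistinguisherRun.lean` (`run_distinguisher`: the
distinguisher accepts iff the emulated attack, with node blocks read off its oracle, forges). The two games of
`IsPRF` (`PseudorandomFunctions.lean`) against the distinguisher `D` of a forger `𝒜` of `TreeSig.scheme P`, with the
ensemble `P.F` keyed by `κ` and queried on `n + 1` bits:

* **`prfRealProb_distinguisher`** — in the real game the blocks are `F n k (code n L)`, the nodes of the genuine tree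
  signer under the seed `k`: `prfRealProb P.F P.κ (· + 1) D n = forgeProb (scheme P) 𝒜 n` (the factorisation
  `forgeProb_eq_uniformAvg` of `TreeSigExperiment.lean`, the distinguisher's coins splitting into the forger's coins
  and the leaves);
* **`prfIdealProb_distinguisher`** — in the ideal game, against a uniformly random table
  `H : {0,1}^{n+1} → {0,1}^{R(n)}`, `prfIdealProb (· + 1) R D n` is the average over the distinguisher's coins `r` of
  the counting probability, over `H`, that `D` accepts — the form in which lazy sampling
  (`Complexity/OracleLazyTables.lean`) applies (`TreeSigLazy.lean`);
* the elementary conversions of the games into finite averages (`prfRealProb_eq_uniformAvg`,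
  `prfIdealProb_eq_uniformAvg`, valid for every oracle adversary).

All statements proved; no named facts.

## References

* O. Goldreich, *Foundations of Cryptography II: Basic Applications*, CUP 2004, §6.4.2.3, proof of Prop. 6.4.17.
* O. Goldreich, S. Goldwasser, S. Micali, *How to construct random functions*, J. ACM 33 (1986), §3 (the two games).
-/

namespace Literature.Computability.Cryptography

open _root_.Computability Complexity Complexity.Brick Polynomial Finset
open Complexity.OracleAlg

/-! ### The PRF games as finite averages -/

section Games

/-- The mass of `some true` under the output law of an oracle adversary on `1ⁿ`, as the uniform average over its coins
of the indicator of acceptance. [Goldreich 2001, Def. 3.6.4] [folklore] -/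
theorem outputPMF_some_true_toReal (𝒜 : OracleAdversary Bool) (O : Oracle) (n : ℕ) :
    (𝒜.outputPMF O (unaryEncodeNat n) (some true)).toReal =
      uniformAvg (𝒜.coins.eval n) fun r => if 𝒜.alg.run O (𝒜.fuel.eval n) (boolPair (unaryEncodeNat n) r) = some true then 1 else 0 := by
  classical
  have hn : (unaryEncodeNat n).length = n := by rw [Complexity.unaryEncodeNat_eq_replicate, List.length_replicate]
  rw [OracleAdversary.outputPMF_eq_map, hn, ← PMF.toOuterMeasure_apply_singleton,
    SignatureScheme.toReal_toOuterMeasure_map_uniform_vector (fun r => 𝒜.alg.run O (𝒜.fuel.eval n) (boolPair (unaryEncodeNat n) r)) {some true}]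
  rfl

/-- **The real PRF game as a double average** over the key and the adversary's coins. [Goldreich 2001, Def. 3.6.4] [folklore] -/
theorem prfRealProb_eq_uniformAvg (F : FunctionEnsemble) (κ ℓin : ℕ → ℕ) (𝒜 : OracleAdversary Bool) (n : ℕ) :
    prfRealProb F κ ℓin 𝒜 n = uniformAvg (κ n) fun k => uniformAvg (𝒜.coins.eval n) fun r =>
      if 𝒜.alg.run (oracleOfFnAt (ℓin n) (F n k)) (𝒜.fuel.eval n) (boolPair (unaryEncodeNat n) r) = some true then 1 else 0 := by
  classical
  rw [prfRealProb, prfRealPMF, uniformBits, PMF.bind_map, PMF.bind_apply, tsum_fintype, ENNReal.toReal_sum (fun v _ => ?_),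
    SigOWF.uniformAvg_eq_sum_div]
  · refine Finset.sum_congr rfl fun v _ => ?_
    rw [ENNReal.toReal_mul, PMF.uniformOfFintype_apply, card_vector, Fintype.card_bool, ENNReal.toReal_inv, Function.comp_apply,
      outputPMF_some_true_toReal]
    simp only [ENNReal.toReal_pow, ENNReal.toReal_ofNat, Nat.cast_pow, Nat.cast_ofNat]
    rw [div_eq_inv_mul]
  · exact ENNReal.mul_ne_top (PMF.apply_ne_top _ _) (PMF.apply_ne_top _ _)

/-- The counting probability, over a uniformly random table, that a deterministic run accepts. [folklore] -/
noncomputable def tableProb {a b : ℕ} (f : (List.Vector Bool a → List.Vector Bool b) → Prop) [DecidablePred f] : ℝ :=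
  ((univ.filter f).card : ℝ) / Fintype.card (List.Vector Bool a → List.Vector Bool b)

/-- `tableProb` only depends on the event (whatever the decidability instances). [folklore] -/
theorem tableProb_congr {a b : ℕ} {f g : (List.Vector Bool a → List.Vector Bool b) → Prop} [DecidablePred f] [DecidablePred g]
    (h : ∀ H, f H ↔ g H) : tableProb f = tableProb g := by
  unfold tableProb
  rw [Finset.filter_congr fun H _ => h H]

/-- **The ideal PRF game as an average over the adversary's coins of a counting probability over the table.**
[Goldreich 2001, Def. 3.6.4 (the uniform function ensemble)] [folklore] -/
theorem prfIdealProb_eq_uniformAvg (ℓin ℓout : ℕ → ℕ) (𝒜 : OracleAdversary Bool) (n : ℕ) :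
    prfIdealProb ℓin ℓout 𝒜 n = uniformAvg (𝒜.coins.eval n) fun r =>
      tableProb fun H : List.Vector Bool (ℓin n) → List.Vector Bool (ℓout n) =>
        𝒜.alg.run (oracleOfTable H) (𝒜.fuel.eval n) (boolPair (unaryEncodeNat n) r) = some true := by
  classical
  rw [prfIdealProb, prfIdealPMF, randomFunctionPMF, PMF.bind_apply, tsum_fintype, ENNReal.toReal_sum (fun H _ => ?_)]
  · simp_rw [ENNReal.toReal_mul, PMF.uniformOfFintype_apply, ENNReal.toReal_inv, ENNReal.toReal_natCast, outputPMF_some_true_toReal]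
    -- swap the two finite averages
    simp only [uniformAvg, tableProb, Finset.mul_sum, Finset.sum_div, Finset.card_filter, Nat.cast_sum, Nat.cast_ite, Nat.cast_one,
      Nat.cast_zero]
    rw [Finset.sum_comm]
    refine Finset.sum_congr rfl fun r _ => Finset.sum_congr rfl fun H _ => ?_
    split_ifs <;> simp [div_eq_inv_mul, mul_comm]
  · exact ENNReal.mul_ne_top (PMF.apply_ne_top _ _) (PMF.apply_ne_top _ _)

end Games

namespace TreeSig

variable {P : Spec} {𝒜 : OracleAdversary (List Bool × List Bool)}

/-! ### The real game: the blocks of the genuine signer -/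

/-- In the real game the oracle is a block oracle: `F n k` maps label codes to blocks of length `R(n) ≥ pG(n)`. [folklore] -/
theorem blockOracle_real (hW : P.WF) {n : ℕ} {k : List Bool} (hk : k.length = P.κ n) : BlockOracle P (oracleOfFnAt (n + 1) (P.F n k)) n := by
  intro L hL
  rw [oracleOfFnAt_apply_of_length_eq _ (length_code hL), hW.hF n k _ hk (length_code hL)]
  exact pG_le_R n

/-- In the real game the block assignment is the genuine one on labels of length `≤ n`. [folklore] -/
theorem blkO_real {n : ℕ} (k : List Bool) {L : List Bool} (hL : L.length ≤ n) : blkO (oracleOfFnAt (n + 1) (P.F n k)) n L = blk P n k L := by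
  rw [blkO, oracleOfFnAt_apply_of_length_eq _ (length_code hL), blk]

/-- In the real game the block-oracle signer is the genuine signer, leaf by leaf. [folklore] -/
theorem OSig_real {n : ℕ} (k ρ : List Bool) (i : ℕ) (α : List Bool) :
    OSig P (oracleOfFnAt (n + 1) (P.F n k)) n ρ i α = sigG P n (blk P n k) α (Yao.blk n i ρ) := by
  have hσ := Yao.length_blk_le n i ρ
  exact sigG_congr n (blkO_real k (by simp)) (fun L hL => blkO_real k ((length_le_of_mem_pathLabels hL).trans hσ)) α

/-- **The real PRF game of the distinguisher is the chosen-message attack on the tree scheme.**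
[Goldreich 2004, proof of Prop. 6.4.17 ("when given oracle access to `f_r`, the emulation is identical to the actual
attack")] [cite: Goldreich2004, Prop. 6.4.17] -/
theorem prfRealProb_distinguisher (hW : P.WF) {B : Bounds} (hB : B.OK P 𝒜) (n : ℕ) :
    prfRealProb P.F P.κ (fun m => m + 1) (distinguisher P 𝒜 B.PcOf (B.cOf P 𝒜) (Bounds.ROf P 𝒜)) n = forgeProb (scheme P) 𝒜 n := by
  classical
  rw [prfRealProb_eq_uniformAvg, forgeProb_eq_uniformAvg P hW 𝒜 n]
  refine SigOWF.uniformAvg_congr' fun k hk => ?_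
  show uniformAvg ((cDPoly P 𝒜).eval n) _ = _
  rw [cDPoly_eval, ← SigOWF.uniformAvg_add' (cA P 𝒜 n) (TA P 𝒜 n * n) fun u w =>
    if ForgeWith P 𝒜 n (rootPk P n k) (fun i α => sigG P n (blk P n k) α (Yao.blk n i w)) u then (1 : ℝ) else 0]
  refine SigOWF.uniformAvg_congr' fun r hr => ?_
  have hrun := run_distinguisher (n := n) hW hB (blockOracle_real hW hk) (r := r) (by rw [cDPoly_eval]; exact hr)
  show (if (distinguisher P 𝒜 B.PcOf (B.cOf P 𝒜) (Bounds.ROf P 𝒜)).alg.run _ ((fuelD P 𝒜).eval n) _ = some true then (1 : ℝ) else 0) = _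
  rw [hrun]
  have hroot : pkOf P n (blkO (oracleOfFnAt (n + 1) (P.F n k)) n []) = rootPk P n k := by rw [blkO_real k (by simp)]; rfl
  have hiff : ForgeWith P 𝒜 n (pkOf P n (blkO (oracleOfFnAt (n + 1) (P.F n k)) n [])) (OSig P (oracleOfFnAt (n + 1) (P.F n k)) n (ρD P 𝒜 n r)) (rA P 𝒜 n r) ↔
      ForgeWith P 𝒜 n (rootPk P n k) (fun i α => sigG P n (blk P n k) α (Yao.blk n i (r.drop (cA P 𝒜 n)))) (r.take (cA P 𝒜 n)) := by
    rw [hroot, forgeWith_congr _ (fun i _ α => OSig_real k _ i α)]; rfl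
  by_cases h : ForgeWith P 𝒜 n (rootPk P n k) (fun i α => sigG P n (blk P n k) α (Yao.blk n i (r.drop (cA P 𝒜 n)))) (r.take (cA P 𝒜 n))
  · rw [if_pos h, if_pos ((decide_eq_true_iff).2 (hiff.2 h) ▸ rfl)]
  · rw [if_neg h, if_neg]
    intro h'
    simp only [Option.some.injEq, decide_eq_true_eq] at h'
    exact h (hiff.1 h')

/-! ### The ideal game: a uniformly random table -/

/-- In the ideal game the oracle is a block oracle. [folklore] -/
theorem blockOracle_table {n : ℕ} (H : List.Vector Bool (n + 1) → List.Vector Bool (P.R.eval n)) : BlockOracle P (oracleOfTable H) n := by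
  intro L hL
  rw [length_oracleOfTable_of_length_eq H (length_code hL)]
  exact pG_le_R n

open scoped Classical in
/-- **The ideal PRF game of the distinguisher** as the average over its coins of the counting probability, over the
random table `H`, of the forgery event of the emulated attack whose nodes are read off `H`.
[Goldreich 2004, proof of Prop. 6.4.17 (the attack on the ideal, truly random, scheme)] [cite: Goldreich2004, Prop. 6.4.17] -/
theorem prfIdealProb_distinguisher (hW : P.WF) {B : Bounds} (hB : B.OK P 𝒜) (n : ℕ) :
    prfIdealProb (fun m => m + 1) (fun m => P.R.eval m) (distinguisher P 𝒜 B.PcOf (B.cOf P 𝒜) (Bounds.ROf P 𝒜)) n =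
      uniformAvg ((cDPoly P 𝒜).eval n) fun r => tableProb fun H : List.Vector Bool (n + 1) → List.Vector Bool (P.R.eval n) =>
        ForgeWith P 𝒜 n (pkOf P n (blkO (oracleOfTable H) n [])) (OSig P (oracleOfTable H) n (ρD P 𝒜 n r)) (rA P 𝒜 n r) := by
  classical
  rw [prfIdealProb_eq_uniformAvg]
  refine SigOWF.uniformAvg_congr' fun r hr => tableProb_congr fun H => ?_
  have hrun := run_distinguisher (n := n) hW hB (blockOracle_table H) (r := r) hr
  change (distinguisher P 𝒜 B.PcOf (B.cOf P 𝒜) (Bounds.ROf P 𝒜)).alg.run (oracleOfTable H) ((fuelD P 𝒜).eval n) (boolPair (unaryEncodeNat n) r) = some true ↔ _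
  rw [hrun]
  simp only [Option.some.injEq, decide_eq_true_eq]

end TreeSig

end Literature.Computability.Cryptography
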